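import Mathlib

/-!
# The assembly step (Tier 5, sub-step N3, Lemma N3.L8 (4))

Kernel annex for Tier 5 (README §7), filed by p8 as a companion to `route/T5-CHECK-N3-p8.md`.
Step (4) of Lemma N3.L8 of `route/T5-N3-route-2.md`: a non-zero vector `x` of the `σ`-isotypic
part that is at once a finite sum of (2,0)-forms of side A and a finite sum of (2,0)-forms of
side B has `0 < ‖x‖² = Σ_{i,j} ⟪F_A^i, F_B^j⟫`, so some single pair `(i, j)` pairs non-trivially —
which is (N) for that datum through N1's identification. Two elementary forms:

* `exists_inner_ne_zero_of_sum_eq` — in an inner product space, if `x = Σ_i a i = Σ_j b j` and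
  `x ≠ 0`, then `⟪a i, b j⟫ ≠ 0` for some `(i, j)`.
* `exists_ne_zero_of_sum_eq_of_bilinear` — the same for any bilinear (or sesquilinear) pairing
  `B` with `B x x ≠ 0`.
-/

namespace Summit.Ventures.HodgeRepro2.T5Reduction

open scoped InnerProductSpace

section Bilinear

variable {R M N P : Type*} [CommSemiring R] [AddCommMonoid M] [Module R M] [AddCommMonoid N]
  [Module R N] [AddCommMonoid P] [Module R P]

/-- A bilinear pairing that is non-zero on `(x, y)` is non-zero on some pair of terms of any two
finite decompositions `x = Σ_i a i`, `y = Σ_j b j`. -/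
theorem exists_ne_zero_of_sum_eq_of_bilinear (B : M →ₗ[R] N →ₗ[R] P) {ι κ : Type*}
    (s : Finset ι) (t : Finset κ) (a : ι → M) (b : κ → N) {x : M} {y : N}
    (hx : x = ∑ i ∈ s, a i) (hy : y = ∑ j ∈ t, b j) (hB : B x y ≠ 0) :
    ∃ i ∈ s, ∃ j ∈ t, B (a i) (b j) ≠ 0 := by
  by_contra hcon
  push Not at hcon
  apply hB
  rw [hx, hy, map_sum]
  refine Finset.sum_eq_zero fun j hj => ?_
  rw [map_sum, LinearMap.coe_sum, Finset.sum_apply]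
  exact Finset.sum_eq_zero fun i hi => hcon i hi j hj

end Bilinear

section Inner

variable {E : Type*} [NormedAddCommGroup E] [InnerProductSpace ℂ E]

/-- Lemma N3.L8 (4): if `0 ≠ x = Σ_i a i = Σ_j b j`, then `⟪a i, b j⟫ ≠ 0` for some `(i, j)`
(positivity of the Petersson form: `0 < ‖x‖² = Σ_{i,j} ⟪a i, b j⟫`). -/
theorem exists_inner_ne_zero_of_sum_eq {ι κ : Type*} (s : Finset ι) (t : Finset κ) (a : ι → E)
    (b : κ → E) {x : E} (hx : x = ∑ i ∈ s, a i) (hy : x = ∑ j ∈ t, b j) (hx0 : x ≠ 0) :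
    ∃ i ∈ s, ∃ j ∈ t, ⟪a i, b j⟫_ℂ ≠ 0 := by
  by_contra hcon
  push Not at hcon
  apply hx0
  have h : ⟪x, x⟫_ℂ = 0 := by
    have hxy : ⟪x, x⟫_ℂ = ⟪∑ i ∈ s, a i, ∑ j ∈ t, b j⟫_ℂ := by
      rw [← hx, ← hy]
    rw [hxy, sum_inner]
    refine Finset.sum_eq_zero fun i hi => ?_
    rw [inner_sum]
    exact Finset.sum_eq_zero fun j hj => hcon i hi j hj
  exact inner_self_eq_zero.1 h

end Inner

end Summit.Ventures.HodgeRepro2.T5Reduction
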